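import Summits.QuantumFields.BalabanUV.T4Continuum.Support.NE7K1LinBoxThm19Holder
import Summits.QuantumFields.BalabanUV.T4Continuum.Support.NE7K1LinBoxThm110DerivForms

/-!
# NE7K1LinBoxThm19HolderForms — row NE7 (node U5), candidate route HOM, path H1L, cell K1-lin(s): card §3y STEP 7, PART 12 (LAST) —
# THE PRINTED HÖLDER CLAUSE (1.9) FOR THE TWO-CUTOFF LINE AND B4's THEOREM (1.9)–(1.10) FOR THE LINE AT `A = 0` ON NEUMANN BOXES WITH
# COMMON CONSTANTS: `ineq19_110_line_box` — EVERY SCALE `k ≥ 1`, EVERY `s ∈ [0,1]`, EVERY `0 ≤ α < 1`, constants in `(d, L, α, a±)` ONLY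

Lineage `b2b-balaban-t4-ne7-p2` (CRUX PROVER NE7 #2), generation 79; file 105 — the end of STEP 7 (files 94–105).  b04's
`B4Thm19ZeroBoxHolder` §7 (printed forms, literal coefficient, the conjunction (1.9) ∧ (1.10)) re-run on file 104's
`thm19_line_box_holder_roww`, file 101's `thm110_line_box_deriv_dist` and file 98's `thm110_line_box_dist`, through b04's `mulVec_dd` ∕
`abs_sum_mul_le_of_wsum2` ∕ `decayBound_mono` ∕ `dsupp` ∕ `cK` ∕ `aSeq_div_cK` BY NAME.

* §1 **`thm19_line_box_holder_value ∕ _dist`**, **`lemma22_line_box_holder_sup`**; §2 **`thm19_line_box_holder_roww_coeff ∕ _value_coeff`**;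
* §3 **`ineq19_110_line_box`** — (1.9) ∧ (1.10) (value and derivative) FOR THE LINE with common `(δ₀, c₀)`; §4 non-vacuity.

WHAT THE CELL STILL LACKS after STEP 7 (HONEST; card §3y): STEP 8 = [13] §3's MULTI-SCALE template (PARAMETRIC for endpoint and line alike),
STEP 9 = the letters at `A ≠ 0` (`…Inst` at `Reg335`, licence X-A7); within STEP 7: the torus variant and general regions (b04: boxes only
as well).  Nothing of Bałaban's asserted; NE7 NOT PRINTED ∕ NOT PROVED.

HONEST FRAMING: [folklore]; A = 0; the LINE is not in [B4] — the print's box route transposed; no `sorry`.  Census only (STEP 7 complete on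
boxes at A = 0); spine 0∕9; FIXED FINITE T⁴, rung (B)+1; NOT infinite volume, NOT mass gap, NOT Clay.  HONEST DEPENDENCY: continuum YM on
T⁴ ⇐ BetaPertH ∧ nine spine estimates (0/9 proved); BetaPertH ⇐ (D1) ∧ (D4) ∧ CAP+tail; G-an2-4 gates asym, D1 and NE2/3/4.
-/

noncomputable section

open Finset Matrix

namespace Summit.QuantumFields.BalabanUV.T4Continuum.NE7K1LinBoxThm19HolderForms

open Literature.MathematicalPhysics.QuantumFieldTheory.Balaban1983to89
open Literature.MathematicalPhysics.QuantumFieldTheory.Balaban1983to89.B4Reflection242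
open Literature.MathematicalPhysics.QuantumFieldTheory.Balaban1983to89.B4Lower18
open Literature.MathematicalPhysics.QuantumFieldTheory.Balaban1983to89.B4ContourShift (supNorm supNorm_nonneg)
open Literature.MathematicalPhysics.QuantumFieldTheory.Balaban1983to89.B4BoxCov237
open Literature.MathematicalPhysics.QuantumFieldTheory.Balaban1983to89.B4Thm110ZeroBox
open Literature.MathematicalPhysics.QuantumFieldTheory.Balaban1983to89.B4Thm110ZeroBoxDeriv
open Literature.MathematicalPhysics.QuantumFieldTheory.Balaban1983to89.B4Thm19ZeroBoxHolder
open NE7K1LinSchurLineU1 NE7K1LinSchurFoldBox NE7K1LinBoxCovEnergy NE7K1LinLineLaplacian NE7K1LinBoxScales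
open NE7K1LinBoxThm110 NE7K1LinBoxThm110DerivForms NE7K1LinBoxThm19Holder

variable {d : ℕ}

/-! ### §1 The printed forms of the Hölder clause for the line -/

/-- **THEOREM (1.9) OF [B4], THE PRINTED HÖLDER CLAUSE, FOR THE TWO-CUTOFF LINE at `A = 0` on rectangular parallelepipeds**
`|x − x′|^{−α}|(D^η_μG^Π_k(s)f)(x′) − (D^η_μG^Π_k(s)f)(x)| ≤ c₀ exp(−δ₀ dist({x,x′}, supp f))‖f‖_∞` for ALL `x ≠ x′` in `□` with `x + ηe_μ,
x′ + ηe_μ ∈ □`: for every `0 ≤ α < 1` there are `δ₀ > 0`, `c₀ > 0` depending only on `d`, `ℓ`, `α` and the window such that for every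
`k ≥ 1` (`η = L^{-k}`), `a` in the window, EVERY `s ∈ [0,1]`, every box, every `f`, every bound `F ≥ |f|`, every axis `μ`, all such
`x, xe, x′, xe′` and every `D` with `D ≤ min(|x − z|_∞, |x′ − z|_∞)` on `supp f`:
`(η|x′−x|_∞)^{-α}·|η^{-1}(((G^Π_k(s)f)(xe′) − (G^Π_k(s)f)(x′)) − ((G^Π_k(s)f)(xe) − (G^Π_k(s)f)(x)))| ≤ c₀·e^{−δ₀ηD}·F` (b04's `mulVec_dd`,
`abs_sum_mul_le_of_wsum2`). [cite: Balaban1983RegularityDecay, Theorem (Prop. 2.1 of [1]) (1.9) p.573, for the two-cutoff line] -/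
theorem thm19_line_box_holder_value (d ℓ : ℕ) (hℓ : 1 ≤ ℓ) (amin aplus : ℝ) (ha : 0 < amin) (α : ℝ)
    (hα0 : 0 ≤ α) (hα1 : α < 1) :
    ∃ δ₀ c₀ : ℝ, 0 < δ₀ ∧ 0 < c₀ ∧ ∀ (k : ℕ), 1 ≤ k → ∀ (a s : ℝ), amin ≤ a → a ≤ aplus → 0 ≤ s →
      s ≤ 1 → ∀ (M : Fin (d + 1) → ℕ), (∀ i, 1 ≤ M i) →
      ∀ (f : ↥(boxDom (fun i => (ℓ + 1) ^ k * M i)) → ℝ) (F D : ℝ), (∀ z, |f z| ≤ F) →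
      ∀ (μ : Fin (d + 1)) (x xe x' xe' : ↥(boxDom (fun i => (ℓ + 1) ^ k * M i))),
        xe.1 = x.1 + Pi.single μ 1 → xe'.1 = x'.1 + Pi.single μ 1 → x'.1 ≠ x.1 →
        (∀ z, f z ≠ 0 → D ≤ min (supNorm (x.1 - z.1)) (supNorm (x'.1 - z.1))) →
        ((((ℓ + 1) ^ k : ℕ) : ℝ) / supNorm (x'.1 - x.1)) ^ α *
          |(((ℓ + 1) ^ k : ℕ) : ℝ) *
            ((((boxLine (ℓ + 1) (Nat.one_le_pow k (ℓ + 1) (Nat.succ_pos ℓ)) M (B1.aSeq a ((ℓ : ℝ) + 1) k) s)⁻¹ *ᵥ f) xe'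
                - ((boxLine (ℓ + 1) (Nat.one_le_pow k (ℓ + 1) (Nat.succ_pos ℓ)) M (B1.aSeq a ((ℓ : ℝ) + 1) k) s)⁻¹ *ᵥ f) x')
              - (((boxLine (ℓ + 1) (Nat.one_le_pow k (ℓ + 1) (Nat.succ_pos ℓ)) M (B1.aSeq a ((ℓ : ℝ) + 1) k) s)⁻¹ *ᵥ f) xe
                - ((boxLine (ℓ + 1) (Nat.one_le_pow k (ℓ + 1) (Nat.succ_pos ℓ)) M (B1.aSeq a ((ℓ : ℝ) + 1) k) s)⁻¹ *ᵥ f) x))|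
          ≤ c₀ * Real.exp (-(δ₀ * D / (((ℓ + 1) ^ k : ℕ) : ℝ))) * F := by
  obtain ⟨δ₀, c₀, hδ0, hc0, h⟩ := thm19_line_box_holder_roww d ℓ hℓ amin aplus ha α hα0 hα1
  refine ⟨δ₀, c₀, hδ0, hc0, ?_⟩
  intro k hk a s h1 h2 h3 h4 M hM f F D hF μ x xe x' xe' hxe hxe' hne hD
  have hW0 : 0 ≤ ((((ℓ + 1) ^ k : ℕ) : ℝ) / supNorm (x'.1 - x.1)) ^ α :=
    Real.rpow_nonneg (div_nonneg (Nat.cast_nonneg _) (supNorm_nonneg _)) α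
  rw [← abs_of_nonneg hW0, ← abs_mul, mulVec_dd]
  exact abs_sum_mul_le_of_wsum2 hδ0.le _ x x' _ (h k hk a s h1 h2 h3 h4 M hM μ x xe x' xe' hxe hxe' hne) f hF hD

/-- **THE SAME WITH THE LITERAL `dist({x,x′}, supp f) = min(dsupp f x, dsupp f x′)`** (b04's `dsupp`), for the line, every
`s ∈ [0,1]`. [cite: Balaban1983RegularityDecay, Theorem (Prop. 2.1 of [1]) (1.9) p.573, for the two-cutoff line] -/
theorem thm19_line_box_holder_dist (d ℓ : ℕ) (hℓ : 1 ≤ ℓ) (amin aplus : ℝ) (ha : 0 < amin) (α : ℝ)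
    (hα0 : 0 ≤ α) (hα1 : α < 1) :
    ∃ δ₀ c₀ : ℝ, 0 < δ₀ ∧ 0 < c₀ ∧ ∀ (k : ℕ), 1 ≤ k → ∀ (a s : ℝ), amin ≤ a → a ≤ aplus → 0 ≤ s →
      s ≤ 1 → ∀ (M : Fin (d + 1) → ℕ), (∀ i, 1 ≤ M i) →
      ∀ (f : ↥(boxDom (fun i => (ℓ + 1) ^ k * M i)) → ℝ) (F : ℝ), (∀ z, |f z| ≤ F) →
      ∀ (μ : Fin (d + 1)) (x xe x' xe' : ↥(boxDom (fun i => (ℓ + 1) ^ k * M i))),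
        xe.1 = x.1 + Pi.single μ 1 → xe'.1 = x'.1 + Pi.single μ 1 → x'.1 ≠ x.1 →
        ((((ℓ + 1) ^ k : ℕ) : ℝ) / supNorm (x'.1 - x.1)) ^ α *
          |(((ℓ + 1) ^ k : ℕ) : ℝ) *
            ((((boxLine (ℓ + 1) (Nat.one_le_pow k (ℓ + 1) (Nat.succ_pos ℓ)) M (B1.aSeq a ((ℓ : ℝ) + 1) k) s)⁻¹ *ᵥ f) xe'
                - ((boxLine (ℓ + 1) (Nat.one_le_pow k (ℓ + 1) (Nat.succ_pos ℓ)) M (B1.aSeq a ((ℓ : ℝ) + 1) k) s)⁻¹ *ᵥ f) x')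
              - (((boxLine (ℓ + 1) (Nat.one_le_pow k (ℓ + 1) (Nat.succ_pos ℓ)) M (B1.aSeq a ((ℓ : ℝ) + 1) k) s)⁻¹ *ᵥ f) xe
                - ((boxLine (ℓ + 1) (Nat.one_le_pow k (ℓ + 1) (Nat.succ_pos ℓ)) M (B1.aSeq a ((ℓ : ℝ) + 1) k) s)⁻¹ *ᵥ f) x))|
          ≤ c₀ * Real.exp (-(δ₀ * min (dsupp f x) (dsupp f x') / (((ℓ + 1) ^ k : ℕ) : ℝ))) * F := by
  obtain ⟨δ₀, c₀, hδ0, hc0, h⟩ := thm19_line_box_holder_value d ℓ hℓ amin aplus ha α hα0 hα1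
  refine ⟨δ₀, c₀, hδ0, hc0, ?_⟩
  intro k hk a s h1 h2 h3 h4 M hM f F hF μ x xe x' xe' hxe hxe' hne
  exact h k hk a s h1 h2 h3 h4 M hM f F _ hF μ x xe x' xe' hxe hxe' hne
    fun z hz => min_le_min (dsupp_le f x z hz) (dsupp_le f x' z hz)

/-- **LEMMA 2.2 (2.16), THE HÖLDER PART, FOR THE LINE at `A = 0`** (the `‖·‖_{1,α}` entry `sup_{x,x′,μ}|x′−x|^{−α}|…|` of (2.14) applied
to `G^Π_k(s)f`): `(η|x′−x|_∞)^{-α}|η^{-1}(dd(G^Π_k(s)f))| ≤ c₀‖f‖_∞` for all `x ≠ x′` with their `μ`-neighbours in `□`, uniformly in `k ≥ 1`,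
`s ∈ [0,1]`, the window and the box. [cite: Balaban1983RegularityDecay, (2.14) p.577, Lemma 2.2 (2.16) p.577; (2.39) p.583, for the
two-cutoff line] -/
theorem lemma22_line_box_holder_sup (d ℓ : ℕ) (hℓ : 1 ≤ ℓ) (amin aplus : ℝ) (ha : 0 < amin) (α : ℝ)
    (hα0 : 0 ≤ α) (hα1 : α < 1) :
    ∃ c₀ : ℝ, 0 < c₀ ∧ ∀ (k : ℕ), 1 ≤ k → ∀ (a s : ℝ), amin ≤ a → a ≤ aplus → 0 ≤ s →
      s ≤ 1 → ∀ (M : Fin (d + 1) → ℕ), (∀ i, 1 ≤ M i) →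
      ∀ (f : ↥(boxDom (fun i => (ℓ + 1) ^ k * M i)) → ℝ) (F : ℝ), (∀ z, |f z| ≤ F) →
      ∀ (μ : Fin (d + 1)) (x xe x' xe' : ↥(boxDom (fun i => (ℓ + 1) ^ k * M i))),
        xe.1 = x.1 + Pi.single μ 1 → xe'.1 = x'.1 + Pi.single μ 1 → x'.1 ≠ x.1 →
        ((((ℓ + 1) ^ k : ℕ) : ℝ) / supNorm (x'.1 - x.1)) ^ α *
          |(((ℓ + 1) ^ k : ℕ) : ℝ) *
            ((((boxLine (ℓ + 1) (Nat.one_le_pow k (ℓ + 1) (Nat.succ_pos ℓ)) M (B1.aSeq a ((ℓ : ℝ) + 1) k) s)⁻¹ *ᵥ f) xe'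
                - ((boxLine (ℓ + 1) (Nat.one_le_pow k (ℓ + 1) (Nat.succ_pos ℓ)) M (B1.aSeq a ((ℓ : ℝ) + 1) k) s)⁻¹ *ᵥ f) x')
              - (((boxLine (ℓ + 1) (Nat.one_le_pow k (ℓ + 1) (Nat.succ_pos ℓ)) M (B1.aSeq a ((ℓ : ℝ) + 1) k) s)⁻¹ *ᵥ f) xe
                - ((boxLine (ℓ + 1) (Nat.one_le_pow k (ℓ + 1) (Nat.succ_pos ℓ)) M (B1.aSeq a ((ℓ : ℝ) + 1) k) s)⁻¹ *ᵥ f) x))| ≤ c₀ * F := by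
  obtain ⟨δ₀, c₀, hδ0, hc0, h⟩ := thm19_line_box_holder_value d ℓ hℓ amin aplus ha α hα0 hα1
  refine ⟨c₀, hc0, ?_⟩
  intro k hk a s h1 h2 h3 h4 M hM f F hF μ x xe x' xe' hxe hxe' hne
  have := h k hk a s h1 h2 h3 h4 M hM f F 0 hF μ x xe x' xe' hxe hxe' hne
    fun z _ => le_min (supNorm_nonneg _) (supNorm_nonneg _)
  simpa using this

/-! ### §2 The literal coefficient `a` of the line

As in files 98 ∕ 101: the running `a_k = B1.aSeq a L k` of (2.34) is a linear bijection of `]0,∞[` in `a` (b04's `cK`, `aSeq_div_cK`), so the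
bounds hold for the box line `boxLine(L^k, M, a, s)` with the literal averaging coefficient `a ∈ [a₋, a₊]` (the object of files 80–93),
every `s ∈ [0,1]`, with the constants of `[a₋, a₊/(1 − L^{-2})]`. -/

/-- **THE HÖLDER CLAUSE (1.9) FOR THE BOX LINE WITH THE LITERAL COEFFICIENT `a`** (two-centre weighted-row form, every `s ∈ [0,1]`).
[cite: Balaban1983RegularityDecay, Theorem (Prop. 2.1 of [1]) (1.9) p.573 with (1.6) p.572, for the two-cutoff line] -/
theorem thm19_line_box_holder_roww_coeff (d ℓ : ℕ) (hℓ : 1 ≤ ℓ) (amin aplus : ℝ) (ha : 0 < amin) (α : ℝ)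
    (hα0 : 0 ≤ α) (hα1 : α < 1) :
    ∃ δ₀ c₀ : ℝ, 0 < δ₀ ∧ 0 < c₀ ∧ ∀ (k : ℕ), 1 ≤ k → ∀ (a s : ℝ), amin ≤ a → a ≤ aplus → 0 ≤ s →
      s ≤ 1 → ∀ (M : Fin (d + 1) → ℕ), (∀ i, 1 ≤ M i) →
        ∀ (μ : Fin (d + 1)) (x xe x' xe' : ↥(boxDom (fun i => (ℓ + 1) ^ k * M i))),
          xe.1 = x.1 + Pi.single μ 1 → xe'.1 = x'.1 + Pi.single μ 1 → x'.1 ≠ x.1 →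
          ∑ z, |((((ℓ + 1) ^ k : ℕ) : ℝ) / supNorm (x'.1 - x.1)) ^ α * ((((ℓ + 1) ^ k : ℕ) : ℝ) *
                (((boxLine (ℓ + 1) (Nat.one_le_pow k (ℓ + 1) (Nat.succ_pos ℓ)) M a s)⁻¹ xe' z - (boxLine (ℓ + 1) (Nat.one_le_pow k (ℓ + 1) (Nat.succ_pos ℓ)) M a s)⁻¹ x' z)
                  - ((boxLine (ℓ + 1) (Nat.one_le_pow k (ℓ + 1) (Nat.succ_pos ℓ)) M a s)⁻¹ xe z - (boxLine (ℓ + 1) (Nat.one_le_pow k (ℓ + 1) (Nat.succ_pos ℓ)) M a s)⁻¹ x z)))|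
              * Real.exp (δ₀ * min (supNorm (x.1 - z.1)) (supNorm (x'.1 - z.1)) / (((ℓ + 1) ^ k : ℕ) : ℝ))
            ≤ c₀ := by
  obtain ⟨δ₀, c₀, hδ0, hc0, h⟩ :=
    thm19_line_box_holder_roww d ℓ hℓ amin (aplus / (1 - ((((ℓ : ℝ) + 1)) ^ 2)⁻¹)) ha α hα0 hα1
  refine ⟨δ₀, c₀, hδ0, hc0, ?_⟩
  intro k hk a s h1 h2 h3 h4 M hM μ x xe x' xe' hxe hxe' hne
  obtain ⟨hr0, hr1⟩ := Linv_sq_bounds hℓ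
  have hc := cK_pos hℓ hk
  have hA1 : amin ≤ a / cK ℓ k := by
    rw [le_div_iff₀ hc]
    calc amin * cK ℓ k ≤ amin * 1 := mul_le_mul_of_nonneg_left (cK_le_one hℓ hk) ha.le
      _ ≤ a := by linarith
  have hA2 : a / cK ℓ k ≤ aplus / (1 - ((((ℓ : ℝ) + 1)) ^ 2)⁻¹) :=
    div_le_div₀ (by linarith) h2 (by linarith) (oneSub_le_cK hℓ hk)
  have := h k hk (a / cK ℓ k) s hA1 hA2 h3 h4 M hM μ x xe x' xe' hxe hxe' hne
  rwa [aSeq_div_cK hℓ hk] at this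

/-- … and the printed Hölder clause for the box line with the literal coefficient, every `s ∈ [0,1]`.
[cite: Balaban1983RegularityDecay, Theorem (Prop. 2.1 of [1]) (1.9) p.573 with (1.6) p.572, for the two-cutoff line] -/
theorem thm19_line_box_holder_value_coeff (d ℓ : ℕ) (hℓ : 1 ≤ ℓ) (amin aplus : ℝ) (ha : 0 < amin) (α : ℝ)
    (hα0 : 0 ≤ α) (hα1 : α < 1) :
    ∃ δ₀ c₀ : ℝ, 0 < δ₀ ∧ 0 < c₀ ∧ ∀ (k : ℕ), 1 ≤ k → ∀ (a s : ℝ), amin ≤ a → a ≤ aplus → 0 ≤ s →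
      s ≤ 1 → ∀ (M : Fin (d + 1) → ℕ), (∀ i, 1 ≤ M i) →
      ∀ (f : ↥(boxDom (fun i => (ℓ + 1) ^ k * M i)) → ℝ) (F D : ℝ), (∀ z, |f z| ≤ F) →
      ∀ (μ : Fin (d + 1)) (x xe x' xe' : ↥(boxDom (fun i => (ℓ + 1) ^ k * M i))),
        xe.1 = x.1 + Pi.single μ 1 → xe'.1 = x'.1 + Pi.single μ 1 → x'.1 ≠ x.1 →
        (∀ z, f z ≠ 0 → D ≤ min (supNorm (x.1 - z.1)) (supNorm (x'.1 - z.1))) →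
        ((((ℓ + 1) ^ k : ℕ) : ℝ) / supNorm (x'.1 - x.1)) ^ α *
          |(((ℓ + 1) ^ k : ℕ) : ℝ) *
            ((((boxLine (ℓ + 1) (Nat.one_le_pow k (ℓ + 1) (Nat.succ_pos ℓ)) M a s)⁻¹ *ᵥ f) xe' - ((boxLine (ℓ + 1) (Nat.one_le_pow k (ℓ + 1) (Nat.succ_pos ℓ)) M a s)⁻¹ *ᵥ f) x')
              - (((boxLine (ℓ + 1) (Nat.one_le_pow k (ℓ + 1) (Nat.succ_pos ℓ)) M a s)⁻¹ *ᵥ f) xe - ((boxLine (ℓ + 1) (Nat.one_le_pow k (ℓ + 1) (Nat.succ_pos ℓ)) M a s)⁻¹ *ᵥ f) x))|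
          ≤ c₀ * Real.exp (-(δ₀ * D / (((ℓ + 1) ^ k : ℕ) : ℝ))) * F := by
  obtain ⟨δ₀, c₀, hδ0, hc0, h⟩ := thm19_line_box_holder_roww_coeff d ℓ hℓ amin aplus ha α hα0 hα1
  refine ⟨δ₀, c₀, hδ0, hc0, ?_⟩
  intro k hk a s h1 h2 h3 h4 M hM f F D hF μ x xe x' xe' hxe hxe' hne hD
  have hW0 : 0 ≤ ((((ℓ + 1) ^ k : ℕ) : ℝ) / supNorm (x'.1 - x.1)) ^ α :=
    Real.rpow_nonneg (div_nonneg (Nat.cast_nonneg _) (supNorm_nonneg _)) α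
  rw [← abs_of_nonneg hW0, ← abs_mul, mulVec_dd]
  exact abs_sum_mul_le_of_wsum2 hδ0.le _ x x' _ (h k hk a s h1 h2 h3 h4 M hM μ x xe x' xe' hxe hxe' hne) f hF hD

/-! ### §3 (1.9)–(1.10) together for the two-cutoff line at `A = 0` on boxes (the shape of b04's `ineq19_110_zero_box`) -/

/-- **THE THEOREM OF [B4] p. 573, INEQUALITIES (1.9) AND (1.10), FOR THE TWO-CUTOFF LINE AT `A = 0` ON RECTANGULAR PARALLELEPIPEDS,
ALL SCALES `k ≥ 1`, EVERY `s ∈ [0,1]`, WITH COMMON CONSTANTS** — the conjunction of the Hölder clause (this file), the derivative clause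
(file 101's `thm110_line_box_deriv_dist`) and the value clause (file 98's `thm110_line_box_dist`), each with the literal `dist(·, supp f)`:
for every `0 ≤ α < 1` there are `δ₀ > 0`, `c₀ > 0` (depending on `d`, `ℓ`, `α` and the window `[a₋,a₊]`) such that for every `k ≥ 1`, `a`
in the window, `s ∈ [0,1]`, every box, every `f` and `F ≥ |f|`, with `G = G^Π_k(s) = (boxLine(L^k, M, a_k, s))⁻¹`:
(1.9) `(η|x′−x|_∞)^{-α}|η^{-1}(((Gf)(xe′) − (Gf)(x′)) − ((Gf)(xe) − (Gf)(x)))| ≤ c₀e^{−δ₀η·min(dsupp f x, dsupp f x′)}F`;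
(1.10) `|η^{-1}((Gf)(xe) − (Gf)(x))| ≤ c₀e^{−δ₀η·dsupp f x}F` and `|(Gf)(x)| ≤ c₀e^{−δ₀η·dsupp f x}F` — for all points (and
`μ`-neighbours) of `□`.  THIS IS STEP 7 OF CARD §3y (the regularity half of B4's Theorem for the line at `A = 0`) on Neumann boxes.
[cite: Balaban1983RegularityDecay, Theorem (Prop. 2.1 of [1]) (1.9)–(1.10) p.573, for the two-cutoff line] -/
theorem ineq19_110_line_box (d ℓ : ℕ) (hℓ : 1 ≤ ℓ) (amin aplus : ℝ) (ha : 0 < amin) (α : ℝ)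
    (hα0 : 0 ≤ α) (hα1 : α < 1) :
    ∃ δ₀ c₀ : ℝ, 0 < δ₀ ∧ 0 < c₀ ∧ ∀ (k : ℕ), 1 ≤ k → ∀ (a s : ℝ), amin ≤ a → a ≤ aplus → 0 ≤ s →
      s ≤ 1 → ∀ (M : Fin (d + 1) → ℕ), (∀ i, 1 ≤ M i) →
      ∀ (f : ↥(boxDom (fun i => (ℓ + 1) ^ k * M i)) → ℝ) (F : ℝ), (∀ z, |f z| ≤ F) →
        (∀ (μ : Fin (d + 1)) (x xe x' xe' : ↥(boxDom (fun i => (ℓ + 1) ^ k * M i))),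
          xe.1 = x.1 + Pi.single μ 1 → xe'.1 = x'.1 + Pi.single μ 1 → x'.1 ≠ x.1 →
          ((((ℓ + 1) ^ k : ℕ) : ℝ) / supNorm (x'.1 - x.1)) ^ α *
            |(((ℓ + 1) ^ k : ℕ) : ℝ) *
              ((((boxLine (ℓ + 1) (Nat.one_le_pow k (ℓ + 1) (Nat.succ_pos ℓ)) M (B1.aSeq a ((ℓ : ℝ) + 1) k) s)⁻¹ *ᵥ f) xe'
                  - ((boxLine (ℓ + 1) (Nat.one_le_pow k (ℓ + 1) (Nat.succ_pos ℓ)) M (B1.aSeq a ((ℓ : ℝ) + 1) k) s)⁻¹ *ᵥ f) x')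
                - (((boxLine (ℓ + 1) (Nat.one_le_pow k (ℓ + 1) (Nat.succ_pos ℓ)) M (B1.aSeq a ((ℓ : ℝ) + 1) k) s)⁻¹ *ᵥ f) xe
                  - ((boxLine (ℓ + 1) (Nat.one_le_pow k (ℓ + 1) (Nat.succ_pos ℓ)) M (B1.aSeq a ((ℓ : ℝ) + 1) k) s)⁻¹ *ᵥ f) x))|
            ≤ c₀ * Real.exp (-(δ₀ * min (dsupp f x) (dsupp f x') / (((ℓ + 1) ^ k : ℕ) : ℝ))) * F)
        ∧ (∀ (μ : Fin (d + 1)) (x xe : ↥(boxDom (fun i => (ℓ + 1) ^ k * M i))), xe.1 = x.1 + Pi.single μ 1 →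
          |(((ℓ + 1) ^ k : ℕ) : ℝ) *
              (((boxLine (ℓ + 1) (Nat.one_le_pow k (ℓ + 1) (Nat.succ_pos ℓ)) M (B1.aSeq a ((ℓ : ℝ) + 1) k) s)⁻¹ *ᵥ f) xe
                - ((boxLine (ℓ + 1) (Nat.one_le_pow k (ℓ + 1) (Nat.succ_pos ℓ)) M (B1.aSeq a ((ℓ : ℝ) + 1) k) s)⁻¹ *ᵥ f) x)|
            ≤ c₀ * Real.exp (-(δ₀ * dsupp f x / (((ℓ + 1) ^ k : ℕ) : ℝ))) * F)
        ∧ (∀ x : ↥(boxDom (fun i => (ℓ + 1) ^ k * M i)),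
          |((boxLine (ℓ + 1) (Nat.one_le_pow k (ℓ + 1) (Nat.succ_pos ℓ)) M (B1.aSeq a ((ℓ : ℝ) + 1) k) s)⁻¹ *ᵥ f) x|
            ≤ c₀ * Real.exp (-(δ₀ * dsupp f x / (((ℓ + 1) ^ k : ℕ) : ℝ))) * F) := by
  obtain ⟨δ₁, c₁, hδ1, hc1, hH⟩ := thm19_line_box_holder_dist d ℓ hℓ amin aplus ha α hα0 hα1
  obtain ⟨δ₂, c₂, hδ2, hc2, hD⟩ := thm110_line_box_deriv_dist d ℓ hℓ amin aplus ha
  obtain ⟨δ₃, c₃, hδ3, hc3, hV⟩ := thm110_line_box_dist d ℓ hℓ amin aplus ha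
  refine ⟨min δ₁ (min δ₂ δ₃), max c₁ (max c₂ c₃), lt_min hδ1 (lt_min hδ2 hδ3), lt_max_iff.2 (Or.inl hc1), ?_⟩
  intro k hk a s h1 h2 h3 h4 M hM f F hF
  have hn : (0 : ℝ) ≤ (((ℓ + 1) ^ k : ℕ) : ℝ) := Nat.cast_nonneg _
  refine ⟨fun μ x xe x' xe' hxe hxe' hne => ?_, fun μ x xe hxe => ?_, fun x => ?_⟩
  · exact (hH k hk a s h1 h2 h3 h4 M hM f F hF μ x xe x' xe' hxe hxe' hne).trans
      (decayBound_mono (le_max_left _ _) (min_le_left _ _) hc1.le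
        (le_min (dsupp_nonneg f x) (dsupp_nonneg f x')) hn ((abs_nonneg _).trans (hF x)))
  · exact (hD k hk a s h1 h2 h3 h4 M hM f F hF μ x xe hxe).trans
      (decayBound_mono ((le_max_left _ _).trans (le_max_right _ _))
        ((min_le_right _ _).trans (min_le_left _ _)) hc2.le (dsupp_nonneg f x) hn ((abs_nonneg _).trans (hF x)))
  · exact (hV k hk a s h1 h2 h3 h4 M hM f F hF x).trans
      (decayBound_mono ((le_max_right _ _).trans (le_max_right _ _))
        ((min_le_right _ _).trans (min_le_right _ _)) hc3.le (dsupp_nonneg f x) hn ((abs_nonneg _).trans (hF x)))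

/-! ### §4 Non-vacuity: the hypotheses are met (`d + 1 = 4`, `L = 2`, `α = 1/2`, window `a ∈ [1/2, 2]`, every `s ∈ [0,1]`) -/

/-- the main theorem at the physical dimension `d + 1 = 4`, `L = 2`, Hölder exponent `α = 1/2`, literal coefficient. -/
example : ∃ δ₀ c₀ : ℝ, 0 < δ₀ ∧ 0 < c₀ ∧ ∀ (k : ℕ), 1 ≤ k → ∀ (a s : ℝ), (1 / 2 : ℝ) ≤ a → a ≤ 2 → 0 ≤ s →
      s ≤ 1 → ∀ (M : Fin (3 + 1) → ℕ), (∀ i, 1 ≤ M i) →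
        ∀ (μ : Fin (3 + 1)) (x xe x' xe' : ↥(boxDom (fun i => (1 + 1) ^ k * M i))),
          xe.1 = x.1 + Pi.single μ 1 → xe'.1 = x'.1 + Pi.single μ 1 → x'.1 ≠ x.1 →
          ∑ z, |((((1 + 1) ^ k : ℕ) : ℝ) / supNorm (x'.1 - x.1)) ^ (1 / 2 : ℝ) * ((((1 + 1) ^ k : ℕ) : ℝ) *
                (((boxLine (1 + 1) (Nat.one_le_pow k (1 + 1) (Nat.succ_pos 1)) M a s)⁻¹ xe' z - (boxLine (1 + 1) (Nat.one_le_pow k (1 + 1) (Nat.succ_pos 1)) M a s)⁻¹ x' z)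
                  - ((boxLine (1 + 1) (Nat.one_le_pow k (1 + 1) (Nat.succ_pos 1)) M a s)⁻¹ xe z - (boxLine (1 + 1) (Nat.one_le_pow k (1 + 1) (Nat.succ_pos 1)) M a s)⁻¹ x z)))|
              * Real.exp (δ₀ * min (supNorm (x.1 - z.1)) (supNorm (x'.1 - z.1)) / (((1 + 1) ^ k : ℕ) : ℝ))
            ≤ c₀ :=
  thm19_line_box_holder_roww_coeff 3 1 le_rfl (1 / 2) 2 (by norm_num) (1 / 2) (by norm_num) (by norm_num)

/-- the quantifier prefix of the theorems is inhabited: `k = 1`, `a = 1`, `s = ½`, `α = 1/2`, the unit cube `M ≡ 1`, the axis `μ = 0`,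
and the points `x = 0`, `xe = e_0`, `x′ = e_1`, `xe′ = e_1 + e_0` of the fine box `{0,1}^4` (`xe = x + e_0`, `xe′ = x′ + e_0`, `x′ ≠ x`). -/
example : (1 : ℕ) ≤ 1 ∧ (1 / 2 : ℝ) ≤ 1 ∧ (1 : ℝ) ≤ 2 ∧ (0 : ℝ) ≤ 1 / 2 ∧ (1 / 2 : ℝ) ≤ 1 ∧ (0 : ℝ) ≤ 1 / 2
    ∧ (1 / 2 : ℝ) < 1
    ∧ (∀ i : Fin (3 + 1), 1 ≤ (fun _ => 1 : Fin (3 + 1) → ℕ) i)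
    ∧ (fun _ => (0 : ℤ)) ∈ boxDom (fun i : Fin (3 + 1) => (1 + 1) ^ 1 * (fun _ => 1 : Fin (3 + 1) → ℕ) i)
    ∧ (Pi.single (0 : Fin (3 + 1)) (1 : ℤ))
        ∈ boxDom (fun i : Fin (3 + 1) => (1 + 1) ^ 1 * (fun _ => 1 : Fin (3 + 1) → ℕ) i)
    ∧ (Pi.single (1 : Fin (3 + 1)) (1 : ℤ))
        ∈ boxDom (fun i : Fin (3 + 1) => (1 + 1) ^ 1 * (fun _ => 1 : Fin (3 + 1) → ℕ) i)
    ∧ (Pi.single (1 : Fin (3 + 1)) (1 : ℤ) + Pi.single (0 : Fin (3 + 1)) (1 : ℤ))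
        ∈ boxDom (fun i : Fin (3 + 1) => (1 + 1) ^ 1 * (fun _ => 1 : Fin (3 + 1) → ℕ) i)
    ∧ (Pi.single (0 : Fin (3 + 1)) (1 : ℤ) : Fin (3 + 1) → ℤ) = (fun _ => (0 : ℤ)) + Pi.single 0 1
    ∧ (Pi.single (1 : Fin (3 + 1)) (1 : ℤ) + Pi.single (0 : Fin (3 + 1)) (1 : ℤ) : Fin (3 + 1) → ℤ)
        = Pi.single (1 : Fin (3 + 1)) (1 : ℤ) + Pi.single 0 1
    ∧ (Pi.single (1 : Fin (3 + 1)) (1 : ℤ) : Fin (3 + 1) → ℤ) ≠ (fun _ => (0 : ℤ)) := by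
  refine ⟨le_rfl, by norm_num, by norm_num, by norm_num, by norm_num, by norm_num, by norm_num, fun _ => le_rfl,
    ?_, ?_, ?_, ?_, ?_, rfl, ?_⟩
  · exact mem_boxDom.2 fun _ => ⟨le_rfl, by norm_num⟩
  · refine mem_boxDom.2 fun i => ?_
    by_cases h : i = 0
    · subst h; simp
    · simp [h]
  · refine mem_boxDom.2 fun i => ?_
    by_cases h : i = 1
    · subst h; simp
    · simp [h]
  · refine mem_boxDom.2 fun i => ?_
    fin_cases i <;> simp
  · funext i
    simp
  · intro h
    have := congrFun h 1
    simp at this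


end Summit.QuantumFields.BalabanUV.T4Continuum.NE7K1LinBoxThm19HolderForms

end
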